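import Mathlib
import HarnessLib
import Summits.ResolutionOfSingularities.ResolutionOfSingularities.Theorems.WildQuotientsWildQuotientResolutionS1aKillNecessity

/-!
# S1a — NECESSITY OF ISOLATION: a certificate `β s^δ` forces `(f)^N ≤ (augIdeal σ : β)` (evaluation at `t = 1`)

[OURS · L1 W4.5c · lead-1 g10; FRAME-STATUS rev11 §4 item 6 (the converse of KC3, easy half)] — NOT statements of the manuscript; counted 0; AI-level work,
weaker than expert review. Crux stmt-ResolutionOfSingularities-17941 `CyclicQuotientFourfolds`, line `s1a-logminvertex` v10, K-side. Route-independent; pure algebra.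

With `admissible_iff_augmentationIdeal_le_span` (p640283: (H1)(βs^δ) ⟺ (a′)_δ) this file shows that KC3's hypotheses are not only sufficient but, up to the
form of (i), NECESSARY for a certificate of shape `β s^δ`: (H2) `(βs^δ)·vertexIdeal^N ≤ augIdeal σ_R` is BY DEFINITION `vertexIdeal^N ≤ 𝔞` (stronger than (i)),
and EVALUATING AT `t = 1` (`R^w → B`, `s ↦ 1`, `fᵢt^{wᵢ} ↦ fᵢ`, `σ_R ↦ σ`) turns it into isolation (ii) `(f)^N ≤ (augIdeal σ : β)` downstairs.
* `evalOne_sigmaT` — evaluation at `t = 1` intertwines `σ_T` and `σ`; `map_augmentationIdeal_sigmaR_evalOne_le`;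
* ★★ `isolation_of_cert` — `CobordantKillCert f w σ … (β s^δ) ⇒ ∃ N, (f)^N ≤ (augIdeal σ : β)`;
* ★ `cobordantKillCert_iff` — `CobordantKillCert … (β s^δ) ⟺ (a′)_δ ∧ ∃ N, vertexIdeal^N ≤ (augIdeal σ_R : β s^δ)`.
-/

set_option linter.dupNamespace false

noncomputable section

open Literature.AlgebraicGeometry.Resolution
open scoped LaurentPolynomial
open LaurentPolynomial
open Summit.ResolutionOfSingularities.ResolutionOfSingularities.Theorems.WildQuotientResolution.S1.CoarseChart

namespace Summit.ResolutionOfSingularities.ResolutionOfSingularities.Theorems.WildQuotientResolution.S1.KillCert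

universe u

variable {B : Type u} [CommRing B] {c : ℕ} (f : Fin c → B) (w : Fin c → ℕ) (σ : B ≃+* B)
  (hσJ : ∀ n : ℕ, ((weightedFiltration f w).ideal n).map (σ : B →+* B) ≤ (weightedFiltration f w).ideal n)
  {p : ℕ} (hp : 0 < p) (hσp : ∀ x : B, (⇑σ)^[p] x = x)

/-- Evaluation at `t = 1` intertwines `σ_T = σ ⊗ id` and `σ`. [folklore] -/
theorem evalOne_sigmaT (x : B[T;T⁻¹]) : eval₂ (RingHom.id B) 1 (sigmaT σ x) = σ (eval₂ (RingHom.id B) 1 x) := by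
  induction x using LaurentPolynomial.induction_on' with
  | add x y hx hy => simp only [map_add, hx, hy]
  | C_mul_T n b =>
    rw [sigmaT_C_mul_T, eval₂_C_mul_T, eval₂_C_mul_T, one_zpow, Units.val_one, mul_one, mul_one, RingHom.id_apply, RingHom.id_apply]

/-- Evaluation at `t = 1` on `R^w`: `fᵢ t^{wᵢ} ↦ fᵢ`. -/
theorem evalOne_u' (i : Fin c) : eval₂ (RingHom.id B) 1 ((cobordantAlgebra.u' f w i : ↥(cobordantAlgebra f w)) : B[T;T⁻¹]) = f i := by
  rw [cobordantAlgebra.coe_u', eval₂_C_mul_T, one_zpow, Units.val_one, mul_one, RingHom.id_apply]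

/-- Evaluation at `t = 1` on `R^w`: `β s^δ ↦ β`. -/
theorem evalOne_shift (β : B) (δ : ℕ) :
    eval₂ (RingHom.id B) 1 ((algebraMap B (↥(cobordantAlgebra f w)) β * cobordantAlgebra.s f w ^ δ : ↥(cobordantAlgebra f w)) : B[T;T⁻¹]) = β := by
  rw [MulMemClass.coe_mul, cobordantAlgebra.coe_algebraMap, cobordantAlgebra.coe_s_pow, map_mul, eval₂_C, eval₂_T, one_zpow, Units.val_one, mul_one,
    RingHom.id_apply]

/-- **The augmentation ideal of `σ_R` evaluates into the augmentation ideal of `σ`** at `t = 1`. [OURS · L1 W4.5c] -/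
theorem map_augmentationIdeal_sigmaR_evalOne_le :
    (augmentationIdeal (sigmaR σ f w hσJ hp hσp)).map ((eval₂ (RingHom.id B) 1).comp (cobordantAlgebra f w).val.toRingHom) ≤ augmentationIdeal σ := by
  rw [augmentationIdeal, Ideal.map_span, Ideal.span_le]
  rintro _ ⟨_, ⟨z, rfl⟩, rfl⟩
  rw [SetLike.mem_coe, RingHom.comp_apply, map_sub, map_sub]
  change eval₂ (RingHom.id B) 1 ((sigmaR σ f w hσJ hp hσp z : ↥(cobordantAlgebra f w)) : B[T;T⁻¹]) - eval₂ (RingHom.id B) 1 (z : B[T;T⁻¹]) ∈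
    augmentationIdeal σ
  rw [coe_sigmaR, evalOne_sigmaT]
  exact sub_mem_augmentationIdeal σ _

/-- ★★ **A CERTIFICATE OF SHAPE `β s^δ` FORCES ISOLATION DOWNSTAIRS**: `(f)^N ≤ (augIdeal σ : β)` — evaluate (H2) at `t = 1`. So hypothesis (ii) of KC3 is
necessary, as (a′) is (`admissible_iff_augmentationIdeal_le_span`). [OURS · L1 W4.5c; NOT a statement of the manuscript] -/
theorem isolation_of_cert (β : B) (δ : ℕ) {g : ↥(cobordantAlgebra f w)}
    (hg : g = algebraMap B (↥(cobordantAlgebra f w)) β * cobordantAlgebra.s f w ^ δ) (hcert : CobordantKillCert f w σ hσJ hp hσp g) :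
    ∃ N : ℕ, Ideal.span (Set.range f) ^ N ≤ (augmentationIdeal σ).colon (Ideal.span {β}) := by
  subst hg
  obtain ⟨-, N, h2⟩ := hcert
  refine ⟨N, fun x hx => ?_⟩
  rw [Ideal.mem_colon_span_singleton, mul_comm]
  let φ : ↥(cobordantAlgebra f w) →+* B := (eval₂ (RingHom.id B) 1).comp (cobordantAlgebra f w).val.toRingHom
  have hφu : ∀ i, φ (cobordantAlgebra.u' f w i) = f i := fun i => evalOne_u' f w i
  have hφg : φ (algebraMap B (↥(cobordantAlgebra f w)) β * cobordantAlgebra.s f w ^ δ) = β := evalOne_shift f w β δ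
  -- `(f) = φ(vertexIdeal)`
  have hV : (cobordantAlgebra.vertexIdeal f w).map φ = Ideal.span (Set.range f) := by
    rw [cobordantAlgebra.vertexIdeal, Ideal.map_span]
    congr 1
    ext y
    constructor
    · rintro ⟨_, ⟨i, rfl⟩, rfl⟩; exact ⟨i, (hφu i).symm⟩
    · rintro ⟨i, rfl⟩; exact ⟨_, ⟨i, rfl⟩, hφu i⟩
  have hx' : β * x ∈ (Ideal.span {algebraMap B (↥(cobordantAlgebra f w)) β * cobordantAlgebra.s f w ^ δ} *
      cobordantAlgebra.vertexIdeal f w ^ N).map φ := by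
    rw [Ideal.map_mul, Ideal.map_pow, hV, Ideal.map_span, Set.image_singleton, hφg]
    exact Ideal.mul_mem_mul (Ideal.mem_span_singleton_self β) hx
  exact map_augmentationIdeal_sigmaR_evalOne_le f w σ hσJ hp hσp (Ideal.map_mono h2 hx')

/-- ★ **THE CERTIFICATE OF SHAPE `β s^δ`, CHARACTERISED**: `CobordantKillCert … (β s^δ) ⟺ (a′)_δ ∧ ∃ N, vertexIdeal^N ≤ (augIdeal σ_R : β s^δ)`.
(KC3_δ says the right-hand side follows from (a′)_δ ∧ (ii) ∧ (i)_δ; `isolation_of_cert` says the left-hand side gives back (ii).)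
[OURS · L1 W4.5c; NOT a statement of the manuscript] -/
theorem cobordantKillCert_iff (β : B) (δ : ℕ) :
    CobordantKillCert f w σ hσJ hp hσp (algebraMap B (↥(cobordantAlgebra f w)) β * cobordantAlgebra.s f w ^ δ) ↔
      (∀ (n : ℕ) (y : B), y ∈ (weightedFiltration f w).ideal n → σ y - y ∈ Ideal.span {β} * (weightedFiltration f w).ideal (n + δ)) ∧
        ∃ N : ℕ, cobordantAlgebra.vertexIdeal f w ^ N ≤ (augmentationIdeal (sigmaR σ f w hσJ hp hσp)).colon
          (Ideal.span {algebraMap B (↥(cobordantAlgebra f w)) β * cobordantAlgebra.s f w ^ δ}) := by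
  constructor
  · rintro ⟨h1, N, h2⟩
    refine ⟨admissible_of_augmentationIdeal_le_span f w σ hσJ hp hσp β δ h1, N, fun x hx => ?_⟩
    rw [Ideal.mem_colon_span_singleton, mul_comm]
    exact h2 (Ideal.mul_mem_mul (Ideal.mem_span_singleton_self _) hx)
  · rintro ⟨hadm, N, hN⟩
    refine ⟨augmentationIdeal_sigmaR_le_span_of_admissible_shift f w σ hσJ hp hσp δ β hadm, N, ?_⟩
    rw [Ideal.mul_le]
    intro r hr a ha
    obtain ⟨r', rfl⟩ := Ideal.mem_span_singleton'.mp hr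
    rw [mul_assoc, mul_comm _ a]
    exact Ideal.mul_mem_left _ _ (Ideal.mem_colon_span_singleton.mp (hN ha))

end Summit.ResolutionOfSingularities.ResolutionOfSingularities.Theorems.WildQuotientResolution.S1.KillCert

end
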